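import Mathlib
import Literature.Computability.AlgebraicComplexity.TavenasHutchinsonFamily
import Literature.Computability.AlgebraicComplexity.TavenasVnWitness

/-!
# Route LacunarySymmetroid — TOWER DOOR, definitions of the witness construction

The seven auxiliary objects of the TOWER WITNESS (`towerThetaWitness_holds`, module …TowerThetaWitness), kept out of the proof files (D-0016):
`subV n I` (sub-sum of Tavenas' `V_n = Σ 2^{vExp n i} X^i` over `I`), `zSumI N u I` (the integer `Σ_{i<N, i∈I} (−1)^i 4^{E_u − (i−u)²}`),
`FP ν P x` (partial Kronecker point `x_j ↦ [j ∈ P]·x^{2^j}`, `z_i ↦ 2^{2^i}` on Tavenas' variables `XZ ν`), `goodIdx ν P` (numerals `< 2^ν` with binary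
support in `P`), `kd B G a u` (lowest `a` base-`B` digits of `u` read in base `G`), `towerP n` (`{t < n² : t mod n < ⌊log₂ n⌋}`), `gT n` (the TOWER
SUBSTITUTION `x_j ↦ y_{⌊j/n⌋}^{2^{j mod n}}` for admissible `j`, `z_i ↦ 2^{2^i}`).  Verbatim from the workfile.
HONEST FRAMING: VP ≠ VNP is NOT proved by any of the tower-door files; `TowerB` (head of LINE (B) `Cruxes/WeakLifting/Lines/tower_graft.lean`) is
OPEN; no `closes` binder of any route is touched (director R300 (2)).  Landing hand: val-sym-eng-2 g7 (P1, director-valiant R300 (3), lead R2806/R2809;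
source `Cruxes/MatrixDescartes/TowerDoorComplete.lean` @ca015990e815 by val-idea-22 g7, crit-6 V#35 PASS).
[cite: Tavenas 2014 (thesis) Lemme 3.36 / Cor. 3.37 — tree modules `…TavenasHutchinsonFamily`, `…TavenasVnWitness`]
-/

set_option linter.dupNamespace false

open Finset Polynomial
open scoped BigOperators

namespace Summit.ValiantsHypothesis.ValiantsHypothesis.Theorems.LacunarySymmetroid.TowerDoor

open Literature.Computability.AlgebraicComplexity
open Literature.Computability.AlgebraicComplexity.TavenasVn

/-- The sub-sum of Tavenas' `V_n` over the index set `I`. -/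
noncomputable def subV (n : ℕ) (I : Finset ℕ) : Polynomial ℤ :=
  ∑ i ∈ range (2 ^ n), if i ∈ I then C ((2 : ℤ) ^ vExp n i) * X ^ i else 0

/-- The integer `Z_u^I = Σ_{i<N, i∈I} (-1)^i 4^{E_u - (i-u)²}`. -/
def zSumI (N u : ℕ) (I : Finset ℕ) : ℤ :=
  ∑ i ∈ range N, if i ∈ I then (-1) ^ i * 4 ^ (N * (N - 1) + u * u - sqd i u) else 0

/-- The partial Kronecker point: `x_j ↦ [j ∈ P] x^{2^j}`, `z_i ↦ 2^{2^i}`. -/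
def FP (ν : ℕ) (P : Finset ℕ) (x : ℝ) : XZ ν → ℝ :=
  Sum.elim (fun j => if (j : ℕ) ∈ P then x ^ 2 ^ (j : ℕ) else 0) (fun i => (2 : ℝ) ^ 2 ^ (i : ℕ))

/-- numerals `< 2^ν` whose binary support lies in `P`. -/
def goodIdx (ν : ℕ) (P : Finset ℕ) : Finset ℕ :=
  (range (2 ^ ν)).filter (fun i => ∀ t < ν, Nat.testBit i t = true → t ∈ P)

/-- digit-wise base change: the base-`B` digits of `u` (lowest `a` of them) read in base `G`. -/
def kd (B G : ℕ) : ℕ → ℕ → ℕ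
  | 0, _ => 0
  | a + 1, u => u % B + G * kd B G a (u / B)

/-- the admissible bit positions `P_n = {t < n² : t mod n < ⌊log₂ n⌋}`. -/
def towerP (n : ℕ) : Finset ℕ := (range (n * n)).filter (fun t => t % n < Nat.log 2 n)

/-- **The tower substitution** `x_j ↦ y_{⌊j/n⌋}^{2^{j mod n}}` for `j mod n < ⌊log₂ n⌋` and `⌊j/n⌋ < n`, else `0`;
`z_i ↦ 2^{2^i}`. -/
noncomputable def gT (n : ℕ) : XZ (n * n) → MvPolynomial (Fin n) ℝ :=
  Sum.elim (fun j => if h : (j : ℕ) % n < Nat.log 2 n ∧ (j : ℕ) / n < n then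
      MvPolynomial.X (⟨(j : ℕ) / n, h.2⟩ : Fin n) ^ 2 ^ ((j : ℕ) % n) else 0)
    (fun i => MvPolynomial.C ((2 : ℝ) ^ 2 ^ (i : ℕ)))

end Summit.ValiantsHypothesis.ValiantsHypothesis.Theorems.LacunarySymmetroid.TowerDoor
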